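import Mathlib
import HarnessLib
import Summits.ResolutionOfSingularities.ResolutionOfSingularities.Theorems.WildQuotientsWildQuotientResolutionS1aKillFreeRootKill
import Summits.ResolutionOfSingularities.ResolutionOfSingularities.Theorems.WildQuotientsWildQuotientResolutionS1aKillInitialJordan

/-!
# S1a — INSTANCE I-1 of the research stub: `ReachLowerInF` holds for the Jordan-block datum `J₄` (root kill, depth 1, every leaf `F = ∅`)

[OURS · L1 W4.5c · lead-1 g12; plan-1 RULING R-F15 (3) «I-1 = THE FIRST INSTANCE in the cheapest form the X-scheme allows: a ROOT KILL germ … `ReachLowerInF p`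
FOR THAT DATUM CLASS as a theorem `reachLowerInF_of_<germ>`», R-F15a (a) «I-1 = MT-J-class root kill», A-KF v1 §3.4] — NOT statements of the manuscript;
counted 0; AI-level work, weaker than expert review. Crux stmt-ResolutionOfSingularities-17941 `CyclicQuotientFourfolds`, line `s1a-logminvertex` v12
(`stub_reachLowerInF`). A BC5-type RUNG of the research stub, not the stub.

THE GERM (as in `…S1aKillInitialJordan`): action data `(X′, X₁, q, ρ, g₀)` with `X′` AFFINE regular (locally Noetherian, separated), `X₁` separated, `q` finite
and `G`-invariant, `G = ⟨g₀⟩` finite with `g₀ ^ p = 1`, and a ring isomorphism `e : Γ(X′, ⊤) ≃ k[x₀..x₃]` intertwining `g₀` with the Jordan block `σ`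
(`x₀ ↦ x₀`, `x_{i+1} ↦ x_{i+1} + x_i`); `f : X₁ → Spec k′` locally of finite type supplies the Noetherian base of every model ((F-T10)).

THE MASTER TREE (X-CERT/R-F15a: depth 1): at the root `(initial, 𝔄₀)` — for ANY root decoration `𝔄₀`, in particular the stub's `ofNodeAtlas h₀` — the
(3,2,1)-centre on the fixed axis is a NAMED PRINCIPAL centre for which `X′` ITSELF is a principal-centre chart (`exists_isPrincipalCentre_initial_of_jordanBlock`,
✓p645001); designated family = that one chart, `U = X′ ⊇ supp ∪ F_𝔄₀`; every realisation is re-decorated by `exists_killAtlas` with `F = π′⁻¹(F_𝔄₀ ∖ X′) = ∅`,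
hence terminal; leaves by (F-T0). No (F-T5), no dimension theory, no badness (A-KF v1 (S3)).

* ★★★ `exists_reachLowerF_initial_of_jordanBlock` — the conclusion of `ReachLowerInF p` for this datum, at the initial model with ANY atlas data;
* `exists_reachLowerF_initial_ofNodeAtlas_of_jordanBlock` — the literal instance (root decoration `NodeAtlasData.ofNodeAtlas h₀`, the stub's).
-/

set_option linter.dupNamespace false

noncomputable section

open CategoryTheory Limits AlgebraicGeometry TopologicalSpace Topology Opposite MvPolynomial
open Literature.AlgebraicGeometry.Resolution Literature.AlgebraicGeometry.RelativeSpec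
open Summit.ResolutionOfSingularities.ResolutionOfSingularities.Theorems.WildQuotientResolution.S1
open Summit.ResolutionOfSingularities.ResolutionOfSingularities.Theorems.WildQuotientResolution.S1.NodeAtlas
open Summit.ResolutionOfSingularities.ResolutionOfSingularities.Theorems.WildQuotientResolution.S1.NpFrame

namespace Summit.ResolutionOfSingularities.ResolutionOfSingularities.Theorems.WildQuotientResolution.S1.GameFrame.GModel

variable {p : ℕ} {X' X₁ : Scheme.{0}} {q : X' ⟶ X₁} {G : Type} [Group G] {ρ : G →* Aut X'} {g₀ : G}

/-- ★★★ **INSTANCE I-1: the Jordan block `J₄` satisfies the conclusion of `ReachLowerInF`** at its initial model with ANY root decoration `𝔄₀`: there is a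
class `P ∋ (initial, 𝔄₀)` of decorated models from every non-terminal member of which a bounded tree inside `P` reaches `μ_F`-lower decorated models.
Master tree: ONE named principal move (the (3,2,1)-centre on the fixed axis, `X′` itself a principal-centre chart), every realisation re-decorated with
EMPTY carried formal locus. [OURS · L1 W4.5c · R-F15 (3) I-1; NOT a statement of the manuscript] -/
theorem exists_reachLowerF_initial_of_jordanBlock [Finite G] (hp : p.Prime) (hG : ∀ g : G, g ∈ Subgroup.zpowers g₀) (hg₀ : g₀ ^ p = 1)
    (hq : ∀ g : G, (ρ g).hom ≫ q = q) [IsIntegral X'] [IsLocallyNoetherian X'] [X'.IsSeparated] [IsAffine X'] [X₁.IsSeparated] [IsFinite q]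
    (hreg : Scheme.IsRegular X') {k' : Type} [Field k'] (f : X₁ ⟶ Spec (.of k')) [LocallyOfFiniteType f]
    {k : Type} [Field k] (σ : MvPolynomial (Fin 4) k ≃+* MvPolynomial (Fin 4) k) (hC : ∀ a : k, σ (C a) = C a)
    (h0 : σ (X 0) = X 0) (h1 : σ (X 1) = X 1 + X 0) (h2 : σ (X 2) = X 2 + X 1) (h3 : σ (X 3) = X 3 + X 2)
    (e : Γ(X', ⊤) ≃+* MvPolynomial (Fin 4) k)
    (hστ : ∀ t : Γ(X', ⊤), e ((ρ g₀⁻¹).hom.appLE ⊤ ⊤ (by rw [Scheme.Hom.preimage_top]) t) = σ (e t))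
    (h₀ : NodeAtlas p (⟨ρ, hq⟩ : ActionOver q G) g₀) (𝔄₀ : NodeAtlasData p (GModel.initial hq h₀).act g₀) :
    ∃ P : ∀ M : GModel p q G ρ g₀, NodeAtlasData p M.act g₀ → Prop,
      P (GModel.initial hq h₀) 𝔄₀ ∧ ∀ (M : GModel p q G ρ g₀) (𝔄 : NodeAtlasData p M.act g₀), P M 𝔄 → ¬ M.Terminal →
        ∃ n : ℕ, TreeF P (fun N 𝔅 => LexLTF N 𝔅 M 𝔄) n M 𝔄 := by
  -- the named principal centre of `J₄` on the initial model, with `X′` a principal-centre chart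
  obtain ⟨𝒦, d, hprin, -, -, hchart⟩ := exists_isPrincipalCentre_initial_of_jordanBlock (p := p) hp.pos hG hg₀ hq hreg σ hC h0 h1 h2 h3 e hστ
  -- the designated family: the single chart `⊤ = X′`
  haveI : IsAffine (⊤ : X'.Opens) := isAffineOpen_top X'
  have hAff : IsAffineHom ((⊤ : X'.Opens).ι ≫ q) := inferInstance
  have hst : ∀ g : G, (ρ g).hom ⁻¹ᵁ (⊤ : X'.Opens) = ⊤ := fun g => Scheme.Hom.preimage_top _
  let O : (GModel.initial (p := p) (g₀ := g₀) hq h₀).act.StableAffineOpens := ⟨⊤, hst, hAff⟩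
  have hO : IsPrincipalCentreChart p (GModel.initial hq h₀).act g₀ 𝒦 d O := hchart O rfl
  have hU : ∀ S : Set (GModel.initial (p := p) (g₀ := g₀) hq h₀).V,
      S ⊆ ⋃ _ : Unit, (O.1 : Set (GModel.initial (p := p) (g₀ := g₀) hq h₀).V) :=
    fun S x _ => Set.mem_iUnion.mpr ⟨(), trivial⟩
  exact exists_reachLowerF_of_coveringKill_datum hp hG f (GModel.initial hq h₀) 𝔄₀ 𝒦 d hprin (fun _ : Unit => O) (fun _ => hO) (hU _) (hU _)

/-- **INSTANCE I-1, literal form**: the conclusion of `ReachLowerInF p` for the `J₄` datum with the stub's root decoration `NodeAtlasData.ofNodeAtlas h₀`.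
[OURS · L1 W4.5c · R-F15 (3) I-1] -/
theorem exists_reachLowerF_initial_ofNodeAtlas_of_jordanBlock [Finite G] (hp : p.Prime) (hG : ∀ g : G, g ∈ Subgroup.zpowers g₀) (hg₀ : g₀ ^ p = 1)
    (hq : ∀ g : G, (ρ g).hom ≫ q = q) [IsIntegral X'] [IsLocallyNoetherian X'] [X'.IsSeparated] [IsAffine X'] [X₁.IsSeparated] [IsFinite q]
    (hreg : Scheme.IsRegular X') {k' : Type} [Field k'] (f : X₁ ⟶ Spec (.of k')) [LocallyOfFiniteType f]
    {k : Type} [Field k] (σ : MvPolynomial (Fin 4) k ≃+* MvPolynomial (Fin 4) k) (hC : ∀ a : k, σ (C a) = C a)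
    (h0 : σ (X 0) = X 0) (h1 : σ (X 1) = X 1 + X 0) (h2 : σ (X 2) = X 2 + X 1) (h3 : σ (X 3) = X 3 + X 2)
    (e : Γ(X', ⊤) ≃+* MvPolynomial (Fin 4) k)
    (hστ : ∀ t : Γ(X', ⊤), e ((ρ g₀⁻¹).hom.appLE ⊤ ⊤ (by rw [Scheme.Hom.preimage_top]) t) = σ (e t))
    (h₀ : NodeAtlas p (⟨ρ, hq⟩ : ActionOver q G) g₀) :
    ∃ P : ∀ M : GModel p q G ρ g₀, NodeAtlasData p M.act g₀ → Prop,
      P (GModel.initial hq h₀) (NodeAtlasData.ofNodeAtlas (p := p) (ρ := (⟨ρ, hq⟩ : ActionOver q G)) (g₀ := g₀) h₀) ∧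
      ∀ (M : GModel p q G ρ g₀) (𝔄 : NodeAtlasData p M.act g₀), P M 𝔄 → ¬ M.Terminal →
        ∃ n : ℕ, TreeF P (fun N 𝔅 => LexLTF N 𝔅 M 𝔄) n M 𝔄 :=
  exists_reachLowerF_initial_of_jordanBlock hp hG hg₀ hq hreg f σ hC h0 h1 h2 h3 e hστ h₀ _

end Summit.ResolutionOfSingularities.ResolutionOfSingularities.Theorems.WildQuotientResolution.S1.GameFrame.GModel

end
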